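import Summits.ValiantsHypothesis.ValiantsHypothesis.Theorems.MatrixDescartes.Negative.MatrixDescartesFalseOfTropicalMonster

/-!
# The Monotone Cycle Law (MCL) for parametric assignment optima, its tropical-door form, and the
# «products collapse to chains» corollary (C2)

Def-free support file for crux `LacunarySymmetroid.MatrixDescartes` (stmt-ValiantsHypothesis-18050), crux idea
`Cruxes/MatrixDescartes/Ideas/cycle-monotone-codes.md` (val-idea-23, technique (d) tropical / patchwork, REFUTE side).

* `monotoneCycleLaw` — if `σ₁` maximises `cost + θ₁·slope` and `σ₂` maximises `cost + θ₂·slope` over all permutations,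
  `θ₁ < θ₂`, then on every common invariant row set `U` (`σ₁ '' U = σ₂ '' U`, e.g. the rows of any union of alternating
  cycles of the pair) the slope mass of `σ₂` is at least that of `σ₁`.  Pairwise (non-consecutive optima), scale-free,
  arbitrary real cell costs / slopes; the 4-line switching (exchange) argument.
* `door_mcl` — the same law for two `IsDominant` terms of ONE tropical design (the data of p164927's
  `TropicalMonster`): exponent mass on every common invariant row set is monotone in `θ`.
* `gadget_on_off`, `gadget_off_on`, `gadget_stays_on`, `gadget_stays_off`, `chain_count`, `products_collapse_to_chain`
  (the counted form: `n` optima with positive gadgets and injective ON-sets ⇒ `n ≤ k + 1`), `block_monotone` (C2′) — corollary C2: a «gadget» (a row set `U` on which a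
  hull member either acts internally or is the identity) with positive slope increment can only switch ON as `θ` grows, one
  with negative increment only OFF; hence among the `2^k` products of `k` disjoint gadgets at most a CHAIN (≤ `k+1` members)
  lies on the upper hull — products never multiply hull vertices behind the tropical door.

No new `def`s; no `sorry`.
-/

open Finset BigOperators

-- The tree layout `Summit.<P>.<Sub>` repeats `ValiantsHypothesis` (single-conjunct summit); the name is mandated.
set_option linter.dupNamespace false

namespace Summit.ValiantsHypothesis.ValiantsHypothesis.Theorems.LacunarySymmetroidMatrixDescartes.MonotoneCycleLaw

open Summit.ValiantsHypothesis.ValiantsHypothesis.Theorems.MatrixDescartes.Negative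

/-- The switched map `σ₂` on `U`, `σ₁` off `U` is a permutation when the two images of `U` agree. -/
theorem exists_switch {N : ℕ} (σ₁ σ₂ : Equiv.Perm (Fin N)) (U : Finset (Fin N))
    (hU : U.image σ₁ = U.image σ₂) :
    ∃ σ₃ : Equiv.Perm (Fin N), (∀ i ∈ U, σ₃ i = σ₂ i) ∧ (∀ i ∉ U, σ₃ i = σ₁ i) := by
  classical
  let g : Fin N → Fin N := fun i => if i ∈ U then σ₂ i else σ₁ i
  have ginj : Function.Injective g := by
    intro i j hij
    change (if i ∈ U then σ₂ i else σ₁ i) = (if j ∈ U then σ₂ j else σ₁ j) at hij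
    by_cases hi : i ∈ U <;> by_cases hj : j ∈ U
    · rw [if_pos hi, if_pos hj] at hij; exact σ₂.injective hij
    · rw [if_pos hi, if_neg hj] at hij
      exfalso
      have hmem : σ₂ i ∈ U.image σ₂ := Finset.mem_image_of_mem _ hi
      rw [← hU, hij] at hmem
      obtain ⟨k, hk, hkj⟩ := Finset.mem_image.mp hmem
      exact hj (σ₁.injective hkj ▸ hk)
    · rw [if_neg hi, if_pos hj] at hij
      exfalso
      have hmem : σ₂ j ∈ U.image σ₂ := Finset.mem_image_of_mem _ hj
      rw [← hU, ← hij] at hmem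
      obtain ⟨k, hk, hki⟩ := Finset.mem_image.mp hmem
      exact hi (σ₁.injective hki ▸ hk)
    · rw [if_neg hi, if_neg hj] at hij; exact σ₁.injective hij
  refine ⟨Equiv.ofBijective g (Finite.injective_iff_bijective.mp ginj), ?_, ?_⟩
  · intro i hi; simp [g, hi]
  · intro i hi; simp [g, hi]

/-- **Monotone Cycle Law** (def-free).  `σ₁` optimal at `θ₁`, `σ₂` optimal at `θ₂ > θ₁` (both over ALL permutations, for
`cost + θ·slope` with cell costs `A` and cell slopes `D`); `U` a common invariant row set.  Then
`∑_{i∈U} D i (σ₁ i) ≤ ∑_{i∈U} D i (σ₂ i)`. -/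
theorem monotoneCycleLaw {N : ℕ} (A D : Fin N → Fin N → ℝ) {θ₁ θ₂ : ℝ} (hθ : θ₁ < θ₂)
    (σ₁ σ₂ : Equiv.Perm (Fin N))
    (h₁ : ∀ τ : Equiv.Perm (Fin N),
      ∑ i, A i (τ i) + θ₁ * ∑ i, D i (τ i) ≤ ∑ i, A i (σ₁ i) + θ₁ * ∑ i, D i (σ₁ i))
    (h₂ : ∀ τ : Equiv.Perm (Fin N),
      ∑ i, A i (τ i) + θ₂ * ∑ i, D i (τ i) ≤ ∑ i, A i (σ₂ i) + θ₂ * ∑ i, D i (σ₂ i))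
    (U : Finset (Fin N)) (hU : U.image σ₁ = U.image σ₂) :
    ∑ i ∈ U, D i (σ₁ i) ≤ ∑ i ∈ U, D i (σ₂ i) := by
  classical
  obtain ⟨σ₃, h3U, h3c⟩ := exists_switch σ₁ σ₂ U hU
  obtain ⟨σ₄, h4U, h4c⟩ := exists_switch σ₂ σ₁ U hU.symm
  have key : ∀ F : Fin N → Fin N → ℝ,
      ∑ i, F i (σ₃ i) + ∑ i, F i (σ₄ i) = ∑ i, F i (σ₁ i) + ∑ i, F i (σ₂ i) := by
    intro F
    rw [← Finset.sum_add_distrib, ← Finset.sum_add_distrib]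
    apply Finset.sum_congr rfl
    intro i _
    by_cases hi : i ∈ U
    · rw [h3U i hi, h4U i hi, add_comm]
    · rw [h3c i hi, h4c i hi]
  have kc := key A
  have ks := key D
  have hvan : ∀ x ∈ (Finset.univ : Finset (Fin N)), x ∉ U → (D x (σ₃ x) - D x (σ₁ x)) = 0 := by
    intro x _ hx; rw [h3c x hx]; exact sub_self _
  have hs3 : (∑ i, D i (σ₃ i)) - ∑ i, D i (σ₁ i) = ∑ i ∈ U, (D i (σ₂ i) - D i (σ₁ i)) := by
    rw [← Finset.sum_sub_distrib, ← Finset.sum_subset (Finset.subset_univ U) hvan]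
    exact Finset.sum_congr rfl (fun i hi => by rw [h3U i hi])
  rw [Finset.sum_sub_distrib] at hs3
  have e1 := h₁ σ₃
  have e2 := h₂ σ₄
  have ks2 : θ₂ * ∑ i, D i (σ₃ i) + θ₂ * ∑ i, D i (σ₄ i) = θ₂ * ∑ i, D i (σ₁ i) + θ₂ * ∑ i, D i (σ₂ i) := by
    rw [← mul_add, ← mul_add, ks]
  have e3 : ∑ i, A i (σ₁ i) + θ₂ * ∑ i, D i (σ₁ i) ≤ ∑ i, A i (σ₃ i) + θ₂ * ∑ i, D i (σ₃ i) := by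
    linarith [e2, kc, ks2]
  have hpos : 0 < θ₂ - θ₁ := sub_pos.mpr hθ
  have e5 : 0 ≤ (∑ i, D i (σ₃ i)) - ∑ i, D i (σ₁ i) := by
    by_contra hneg
    have hneg' : (∑ i, D i (σ₃ i)) - ∑ i, D i (σ₁ i) < 0 := lt_of_not_ge hneg
    have hprod := mul_neg_of_pos_of_neg hpos hneg'
    nlinarith [e1, e3, hprod]
  linarith [e5, hs3]

/-! ## C2 — gadgets switch at most once; products collapse to chains -/

theorem image_eq_of_mapsTo {N : ℕ} (σ : Equiv.Perm (Fin N)) (U : Finset (Fin N))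
    (h : ∀ i ∈ U, σ i ∈ U) : U.image σ = U := by
  classical
  apply Finset.eq_of_subset_of_card_le
  · intro x hx
    obtain ⟨i, hi, rfl⟩ := Finset.mem_image.mp hx
    exact h i hi
  · rw [Finset.card_image_of_injective U σ.injective]

theorem image_eq_of_fixes {N : ℕ} (σ : Equiv.Perm (Fin N)) (U : Finset (Fin N))
    (h : ∀ i ∈ U, σ i = i) : U.image σ = U :=
  image_eq_of_mapsTo σ U (fun i hi => by rw [h i hi]; exact hi)

/-- **C2a.** A gadget (row set `U`) that is ON in the `θ₁`-optimum (`σ₁` acts inside `U`) and OFF in the `θ₂`-optimum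
(`σ₂` is the identity on `U`), `θ₁ < θ₂`, carries at most the diagonal slope: turning it on did not increase slope. -/
theorem gadget_on_off {N : ℕ} (A D : Fin N → Fin N → ℝ) {θ₁ θ₂ : ℝ} (hθ : θ₁ < θ₂)
    (σ₁ σ₂ : Equiv.Perm (Fin N))
    (h₁ : ∀ τ : Equiv.Perm (Fin N),
      ∑ i, A i (τ i) + θ₁ * ∑ i, D i (τ i) ≤ ∑ i, A i (σ₁ i) + θ₁ * ∑ i, D i (σ₁ i))
    (h₂ : ∀ τ : Equiv.Perm (Fin N),
      ∑ i, A i (τ i) + θ₂ * ∑ i, D i (τ i) ≤ ∑ i, A i (σ₂ i) + θ₂ * ∑ i, D i (σ₂ i))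
    (U : Finset (Fin N)) (hon : ∀ i ∈ U, σ₁ i ∈ U) (hoff : ∀ i ∈ U, σ₂ i = i) :
    ∑ i ∈ U, D i (σ₁ i) ≤ ∑ i ∈ U, D i i := by
  have hU : U.image σ₁ = U.image σ₂ := by
    rw [image_eq_of_mapsTo σ₁ U hon, image_eq_of_fixes σ₂ U hoff]
  calc ∑ i ∈ U, D i (σ₁ i) ≤ ∑ i ∈ U, D i (σ₂ i) := monotoneCycleLaw A D hθ σ₁ σ₂ h₁ h₂ U hU
    _ = ∑ i ∈ U, D i i := Finset.sum_congr rfl (fun i hi => by rw [hoff i hi])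

/-- **C2b.** Symmetrically: OFF at `θ₁`, ON at `θ₂ > θ₁` ⇒ the gadget's slope on `U` is at least the diagonal slope. -/
theorem gadget_off_on {N : ℕ} (A D : Fin N → Fin N → ℝ) {θ₁ θ₂ : ℝ} (hθ : θ₁ < θ₂)
    (σ₁ σ₂ : Equiv.Perm (Fin N))
    (h₁ : ∀ τ : Equiv.Perm (Fin N),
      ∑ i, A i (τ i) + θ₁ * ∑ i, D i (τ i) ≤ ∑ i, A i (σ₁ i) + θ₁ * ∑ i, D i (σ₁ i))
    (h₂ : ∀ τ : Equiv.Perm (Fin N),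
      ∑ i, A i (τ i) + θ₂ * ∑ i, D i (τ i) ≤ ∑ i, A i (σ₂ i) + θ₂ * ∑ i, D i (σ₂ i))
    (U : Finset (Fin N)) (hoff : ∀ i ∈ U, σ₁ i = i) (hon : ∀ i ∈ U, σ₂ i ∈ U) :
    ∑ i ∈ U, D i i ≤ ∑ i ∈ U, D i (σ₂ i) := by
  have hU : U.image σ₁ = U.image σ₂ := by
    rw [image_eq_of_fixes σ₁ U hoff, image_eq_of_mapsTo σ₂ U hon]
  calc ∑ i ∈ U, D i i = ∑ i ∈ U, D i (σ₁ i) := Finset.sum_congr rfl (fun i hi => by rw [hoff i hi])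
    _ ≤ ∑ i ∈ U, D i (σ₂ i) := monotoneCycleLaw A D hθ σ₁ σ₂ h₁ h₂ U hU

/-- **C2 (products collapse to chains).** A gadget with POSITIVE slope increment that is ON at `θ₁` is never OFF at any
`θ₂ > θ₁`: ON-sets of hull members grow with `θ`, so the hull meets the `2^k` products of `k` disjoint positive gadgets in a
chain of at most `k + 1` members. -/
theorem gadget_stays_on {N : ℕ} (A D : Fin N → Fin N → ℝ) {θ₁ θ₂ : ℝ} (hθ : θ₁ < θ₂)
    (σ₁ σ₂ : Equiv.Perm (Fin N))
    (h₁ : ∀ τ : Equiv.Perm (Fin N),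
      ∑ i, A i (τ i) + θ₁ * ∑ i, D i (τ i) ≤ ∑ i, A i (σ₁ i) + θ₁ * ∑ i, D i (σ₁ i))
    (h₂ : ∀ τ : Equiv.Perm (Fin N),
      ∑ i, A i (τ i) + θ₂ * ∑ i, D i (τ i) ≤ ∑ i, A i (σ₂ i) + θ₂ * ∑ i, D i (σ₂ i))
    (U : Finset (Fin N)) (hon : ∀ i ∈ U, σ₁ i ∈ U) (hinc : ∑ i ∈ U, D i i < ∑ i ∈ U, D i (σ₁ i)) :
    ¬ (∀ i ∈ U, σ₂ i = i) := fun hoff =>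
  absurd (gadget_on_off A D hθ σ₁ σ₂ h₁ h₂ U hon hoff) (not_le.mpr hinc)

/-- **C2, negative-increment form.** A gadget with NEGATIVE increment that is OFF at `θ₁` is never ON at `θ₂ > θ₁`. -/
theorem gadget_stays_off {N : ℕ} (A D : Fin N → Fin N → ℝ) {θ₁ θ₂ : ℝ} (hθ : θ₁ < θ₂)
    (σ₁ σ₂ : Equiv.Perm (Fin N))
    (h₁ : ∀ τ : Equiv.Perm (Fin N),
      ∑ i, A i (τ i) + θ₁ * ∑ i, D i (τ i) ≤ ∑ i, A i (σ₁ i) + θ₁ * ∑ i, D i (σ₁ i))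
    (h₂ : ∀ τ : Equiv.Perm (Fin N),
      ∑ i, A i (τ i) + θ₂ * ∑ i, D i (τ i) ≤ ∑ i, A i (σ₂ i) + θ₂ * ∑ i, D i (σ₂ i))
    (U : Finset (Fin N)) (hoff : ∀ i ∈ U, σ₁ i = i) (hon : ∀ i ∈ U, σ₂ i ∈ U)
    (hdec : ∑ i ∈ U, D i (σ₂ i) < ∑ i ∈ U, D i i) : False :=
  absurd (gadget_off_on A D hθ σ₁ σ₂ h₁ h₂ U hoff hon) (not_le.mpr hdec)




/-- **C2′ (block families are chains in the product order).**  If a row block `B` is mapped into itself by both optima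
(`θ₁ < θ₂`), the slope mass on `B` is monotone: `∑_{B} D i (σ₁ i) ≤ ∑_{B} D i (σ₂ i)`.  Hence for a family acting blockwise on a
fixed partition `B₁ ⊔ … ⊔ B_t` the block-slope vectors of hull members are pairwise comparable coordinatewise (a chain in the
product order), so at most `Σ_i (r_i − 1) + 1` of them are hull vertices (`r_i` = number of block-slope values in block `i`):
cyclic «Landau» orbit codes (`2^{Θ(√(N log N))}` members) and wreath-product codes collapse to `O(N)` / `O(N^{3/2})`. -/
theorem block_monotone {N : ℕ} (A D : Fin N → Fin N → ℝ) {θ₁ θ₂ : ℝ} (hθ : θ₁ < θ₂)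
    (σ₁ σ₂ : Equiv.Perm (Fin N))
    (h₁ : ∀ τ : Equiv.Perm (Fin N),
      ∑ i, A i (τ i) + θ₁ * ∑ i, D i (τ i) ≤ ∑ i, A i (σ₁ i) + θ₁ * ∑ i, D i (σ₁ i))
    (h₂ : ∀ τ : Equiv.Perm (Fin N),
      ∑ i, A i (τ i) + θ₂ * ∑ i, D i (τ i) ≤ ∑ i, A i (σ₂ i) + θ₂ * ∑ i, D i (σ₂ i))
    (B : Finset (Fin N)) (hB₁ : ∀ i ∈ B, σ₁ i ∈ B) (hB₂ : ∀ i ∈ B, σ₂ i ∈ B) :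
    ∑ i ∈ B, D i (σ₁ i) ≤ ∑ i ∈ B, D i (σ₂ i) :=
  monotoneCycleLaw A D hθ σ₁ σ₂ h₁ h₂ B (by rw [image_eq_of_mapsTo σ₁ B hB₁, image_eq_of_mapsTo σ₂ B hB₂])


/-- Counting: an injective chain of subsets of a `k`-set indexed by `Fin n` has `n ≤ k + 1`. -/
theorem chain_count {n k : ℕ} (on : Fin n → Finset (Fin k))
    (hmono : ∀ j j' : Fin n, j < j' → on j ⊆ on j') (hinj : Function.Injective on) : n ≤ k + 1 := by
  classical
  have hsm : StrictMono (fun j => (on j).card) := by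
    intro j j' hjj'
    exact Finset.card_lt_card
      (Finset.ssubset_iff_subset_ne.mpr ⟨hmono j j' hjj', fun h => (ne_of_lt hjj') (hinj h)⟩)
  have hle : ∀ j, (on j).card ≤ k := fun j => by
    simpa using Finset.card_le_univ (on j)
  let f : Fin n → Fin (k + 1) := fun j => ⟨(on j).card, Nat.lt_succ_of_le (hle j)⟩
  have finj : Function.Injective f := by
    intro j j' h
    exact hsm.injective (by simpa [f] using congrArg Fin.val h)
  simpa using Fintype.card_le_of_injective f finj

/-- **C2 (products collapse to chains), counted.**  `n` optima `σ j` at strictly increasing parameters `θ j`; `k` gadgets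
(row sets `U g`, not necessarily disjoint) inside each of which every `σ j` acts; every `σ j` is, on every gadget, either the
identity (OFF) or has positive slope increment (ON, `g ∈ on j`); members are determined by their ON-sets.  Then ON-sets form a
chain and `n ≤ k + 1`: the `2^k` on/off products contribute at most `k + 1` hull vertices. -/
theorem products_collapse_to_chain {N n k : ℕ} (A D : Fin N → Fin N → ℝ) (θ : Fin n → ℝ) (hθ : StrictMono θ)
    (σ : Fin n → Equiv.Perm (Fin N))
    (hopt : ∀ (j : Fin n) (τ : Equiv.Perm (Fin N)),
      ∑ i, A i (τ i) + θ j * ∑ i, D i (τ i) ≤ ∑ i, A i (σ j i) + θ j * ∑ i, D i (σ j i))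
    (U : Fin k → Finset (Fin N)) (hins : ∀ g j, ∀ i ∈ U g, σ j i ∈ U g)
    (on : Fin n → Finset (Fin k))
    (hon : ∀ j g, g ∈ on j → ∑ i ∈ U g, D i i < ∑ i ∈ U g, D i (σ j i))
    (hoff : ∀ j g, g ∉ on j → ∀ i ∈ U g, σ j i = i)
    (hinj : Function.Injective on) : n ≤ k + 1 := by
  classical
  refine chain_count on ?_ hinj
  intro j j' hjj' g hg
  by_contra hg'
  exact gadget_stays_on A D (hθ hjj') (σ j) (σ j') (hopt j) (hopt j') (U g) (hins g j) (hon j g hg) (hoff j' g hg')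


/-- **MCL at the door.** For ONE tropical design `(d, v, ε)`: if the term `p₁ = (σ₁, λ₁)` is dominant at `θ₁` and
`p₂ = (σ₂, λ₂)` is dominant at `θ₂ > θ₁`, then for every row set `U` with `σ₁ '' U = σ₂ '' U`,
`∑_{i ∈ U} d (λ₁ i) ≤ ∑_{i ∈ U} d (λ₂ i)`.  In particular every pair `p j, p k` (`j < k`) of a `TropicalMonster`
witness is cycle-monotone. -/
theorem door_mcl {m K : ℕ} (d : Fin K → ℕ) (v ε : Fin m → Fin m → Fin K → ℤ) {θ₁ θ₂ : ℤ} (hθ : θ₁ < θ₂)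
    {p₁ p₂ : Equiv.Perm (Fin m) × (Fin m → Fin K)}
    (h₁ : IsDominant d v ε θ₁ p₁) (h₂ : IsDominant d v ε θ₂ p₂)
    (U : Finset (Fin m)) (hU : U.image p₁.1 = U.image p₂.1) :
    ∑ i ∈ U, (d (p₁.2 i) : ℤ) ≤ ∑ i ∈ U, (d (p₂.2 i) : ℤ) := by
  classical
  obtain ⟨σ₃, h3U, h3c⟩ := exists_switch p₁.1 p₂.1 U hU
  obtain ⟨σ₄, h4U, h4c⟩ := exists_switch p₂.1 p₁.1 U hU.symm
  let l₃ : Fin m → Fin K := fun i => if i ∈ U then p₂.2 i else p₁.2 i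
  let l₄ : Fin m → Fin K := fun i => if i ∈ U then p₁.2 i else p₂.2 i
  let p₃ : Equiv.Perm (Fin m) × (Fin m → Fin K) := (σ₃, l₃)
  let p₄ : Equiv.Perm (Fin m) × (Fin m → Fin K) := (σ₄, l₄)
  -- row-wise description of the switches
  have r3 : ∀ i, (p₃.1 i, p₃.2 i) = if i ∈ U then (p₂.1 i, p₂.2 i) else (p₁.1 i, p₁.2 i) := by
    intro i; by_cases hi : i ∈ U
    · simp [p₃, l₃, hi, h3U i hi]
    · simp [p₃, l₃, hi, h3c i hi]
  have r4 : ∀ i, (p₄.1 i, p₄.2 i) = if i ∈ U then (p₁.1 i, p₁.2 i) else (p₂.1 i, p₂.2 i) := by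
    intro i; by_cases hi : i ∈ U
    · simp [p₄, l₄, hi, h4U i hi]
    · simp [p₄, l₄, hi, h4c i hi]
  -- the exchange identity for any row functional G (column, row, class) ↦ ℤ
  have key : ∀ G : Fin m → Fin m → Fin K → ℤ,
      ∑ i, G (p₃.1 i) i (p₃.2 i) + ∑ i, G (p₄.1 i) i (p₄.2 i)
        = ∑ i, G (p₁.1 i) i (p₁.2 i) + ∑ i, G (p₂.1 i) i (p₂.2 i) := by
    intro G
    rw [← Finset.sum_add_distrib, ← Finset.sum_add_distrib]
    apply Finset.sum_congr rfl
    intro i _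
    have e3 := r3 i
    have e4 := r4 i
    by_cases hi : i ∈ U
    · rw [if_pos hi] at e3 e4
      rw [(Prod.mk.injEq _ _ _ _).mp e3 |>.1, (Prod.mk.injEq _ _ _ _).mp e3 |>.2,
          (Prod.mk.injEq _ _ _ _).mp e4 |>.1, (Prod.mk.injEq _ _ _ _).mp e4 |>.2, add_comm]
    · rw [if_neg hi] at e3 e4
      rw [(Prod.mk.injEq _ _ _ _).mp e3 |>.1, (Prod.mk.injEq _ _ _ _).mp e3 |>.2,
          (Prod.mk.injEq _ _ _ _).mp e4 |>.1, (Prod.mk.injEq _ _ _ _).mp e4 |>.2]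
  -- S and V
  have kS := key (fun _ _ l => (d l : ℤ))
  have kV := key v
  -- presence of the switched terms
  have fac1 : ∀ i, ε (p₁.1 i) i (p₁.2 i) ≠ 0 := by
    intro i
    have h := h₁.1
    unfold termSign at h
    exact Finset.prod_ne_zero_iff.mp (right_ne_zero_of_mul h) i (Finset.mem_univ i)
  have fac2 : ∀ i, ε (p₂.1 i) i (p₂.2 i) ≠ 0 := by
    intro i
    have h := h₂.1
    unfold termSign at h
    exact Finset.prod_ne_zero_iff.mp (right_ne_zero_of_mul h) i (Finset.mem_univ i)
  have pres3 : termSign ε p₃ ≠ 0 := by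
    unfold termSign
    refine mul_ne_zero (Units.ne_zero _) (Finset.prod_ne_zero_iff.mpr ?_)
    intro i _
    have e3 := r3 i
    by_cases hi : i ∈ U
    · rw [if_pos hi] at e3
      rw [(Prod.mk.injEq _ _ _ _).mp e3 |>.1, (Prod.mk.injEq _ _ _ _).mp e3 |>.2]; exact fac2 i
    · rw [if_neg hi] at e3
      rw [(Prod.mk.injEq _ _ _ _).mp e3 |>.1, (Prod.mk.injEq _ _ _ _).mp e3 |>.2]; exact fac1 i
  have pres4 : termSign ε p₄ ≠ 0 := by
    unfold termSign
    refine mul_ne_zero (Units.ne_zero _) (Finset.prod_ne_zero_iff.mpr ?_)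
    intro i _
    have e4 := r4 i
    by_cases hi : i ∈ U
    · rw [if_pos hi] at e4
      rw [(Prod.mk.injEq _ _ _ _).mp e4 |>.1, (Prod.mk.injEq _ _ _ _).mp e4 |>.2]; exact fac1 i
    · rw [if_neg hi] at e4
      rw [(Prod.mk.injEq _ _ _ _).mp e4 |>.1, (Prod.mk.injEq _ _ _ _).mp e4 |>.2]; exact fac2 i
  -- optimality inequalities (≤ form, covering the case p₃ = p₁)
  have e1 : tropWeight d v θ₁ p₃ ≤ tropWeight d v θ₁ p₁ := by
    by_cases hp : p₃ = p₁
    · rw [hp]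
    · exact le_of_lt (h₁.2 p₃ hp pres3)
  have e2 : tropWeight d v θ₂ p₄ ≤ tropWeight d v θ₂ p₂ := by
    by_cases hp : p₄ = p₂
    · rw [hp]
    · exact le_of_lt (h₂.2 p₄ hp pres4)
  unfold tropWeight at e1 e2
  -- S₃ - S₁ on U
  have hvan : ∀ x ∈ (Finset.univ : Finset (Fin m)), x ∉ U → ((d (p₃.2 x) : ℤ) - (d (p₁.2 x) : ℤ)) = 0 := by
    intro x _ hx
    have e3 := r3 x
    rw [if_neg hx] at e3
    rw [(Prod.mk.injEq _ _ _ _).mp e3 |>.2]; exact sub_self _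
  have hs3 : ∑ i, (d (p₃.2 i) : ℤ) - ∑ i, (d (p₁.2 i) : ℤ) = ∑ i ∈ U, ((d (p₂.2 i) : ℤ) - (d (p₁.2 i) : ℤ)) := by
    rw [← Finset.sum_sub_distrib, ← Finset.sum_subset (Finset.subset_univ U) hvan]
    refine Finset.sum_congr rfl (fun i hi => ?_)
    have e3 := r3 i
    rw [if_pos hi] at e3
    rw [(Prod.mk.injEq _ _ _ _).mp e3 |>.2]
  rw [Finset.sum_sub_distrib] at hs3
  -- arithmetic
  set S₁ := ∑ i, (d (p₁.2 i) : ℤ) with hS₁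
  set S₂ := ∑ i, (d (p₂.2 i) : ℤ) with hS₂
  set S₃ := ∑ i, (d (p₃.2 i) : ℤ) with hS₃
  set S₄ := ∑ i, (d (p₄.2 i) : ℤ) with hS₄
  set V₁ := ∑ i, v (p₁.1 i) i (p₁.2 i) with hV₁
  set V₂ := ∑ i, v (p₂.1 i) i (p₂.2 i) with hV₂
  set V₃ := ∑ i, v (p₃.1 i) i (p₃.2 i) with hV₃
  set V₄ := ∑ i, v (p₄.1 i) i (p₄.2 i) with hV₄
  have ks2 : θ₂ * S₃ + θ₂ * S₄ = θ₂ * S₁ + θ₂ * S₂ := by rw [← mul_add, ← mul_add, kS]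
  have e3 : θ₂ * S₁ - V₁ ≤ θ₂ * S₃ - V₃ := by linarith [e2, kV, ks2]
  have hpos : 0 < θ₂ - θ₁ := sub_pos.mpr hθ
  have e5 : 0 ≤ S₃ - S₁ := by
    by_contra hneg
    have hneg := lt_of_not_ge hneg
    have hprod := mul_neg_of_pos_of_neg hpos hneg
    nlinarith [e1, e3, hprod]
  linarith [e5, hs3]

end Summit.ValiantsHypothesis.ValiantsHypothesis.Theorems.LacunarySymmetroidMatrixDescartes.MonotoneCycleLaw
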